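import Summits.HodgeConjecture.HodgeConjecture.Theorems.Ring2HypothesesDescentMotivatedTraceFormulaPairing
import Literature.AlgebraicGeometry.HodgeTheory.AbsoluteHodgeClassesKunnethComponentsExist
import Summits.HodgeConjecture.HodgeConjecture.Theorems.Ring2HypothesesDescentFibreClassRetracts
import Summits.HodgeConjecture.CorCM.Stage4StrictRoadDischargePowers
import HarnessLib

/-!
# Ring 2 hypotheses, descent face — THE EVEN FIBRE-CLASS LEFSCHETZ NODE ONE RUNG UP CARRIES THE ODD-DEGREE FIBRE-CLASS
# INVERSES: (β′) for the product pencil `B × 𝒴 ⟶ S` gives, by a PARTIAL TRACE over `B`, algebraic fibre-class inverses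
# on `𝒴` in EVERY degree (two-point form); hence `(β′)_{d+1} ⟹` all-degree inverses on every CM-pointed pencil of
# abelian `d`-folds

research route conditional on HC_CM; not a corollary; Q11.4-sentence-2 already refuted in dim ≥ 3.
Cell `pub-hodge-ring2` (Hodge ladder STAGE 3), seat `ring2-b05` (binder row b05 `Ring2.Hypotheses.MotivatedImpliesAlgebraicAV`,
published modulo X = `Ring2.AbelianAll.LefschetzBCompactPencils`), gen 46, second file. `HC_CM`
(`Theses.RankFourFaces.CMAbelianHodge`) does not occur in this file; nothing here proves a case of the Hodge conjecture; no
binder is discharged; the β-nodes `FibreClassLefschetzOn[CMPointed]Pencils`, their rungs `(β′)_d` and X stay OPEN and are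
displayed as hypotheses only.

THE QUESTION (gen 45's open item «§odd-beta»). The node (β′) `FibreClassLefschetzOn hf` asks, for a compact pencil
`f : 𝒴 ⟶ S` of abelian `d`-folds, for algebraic inverses of `L_t = J_{t*} J_t^*` on fibre restrictions in the EVEN degrees only;
gen 45's all-degree Tankeev assembly (`lefschetzB_pencil_of_lerayPieces_deg`) needs them in the ODD degrees too (displayed
there). THIS FILE: the odd-degree inverses on `𝒴` follow from the EVEN node on the product pencil `B × 𝒴 ⟶ S` (one rung up).
THE CONSTRUCTION (partial trace). Let `π ∈ H^{2g}((B ⊗ B)(ℂ); ℂ)` be ALGEBRAIC, in ONE Künneth piece `Hᵉ(B) ⊗ H^{e'}(B)`, with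
`Δ_B^* π ≠ 0` (for `e = 1`: the Künneth component of `cl(Δ_B)`, first gen-46 file). Given the (β′)-inverse
`T : H^{2q+2}(B × 𝒴) → H^{2q}(B × 𝒴)`, `e' + k = 2q`, put `T' := κ · pr_{𝒴*} ∘ m^* ∘ (B ◁ T) ∘ (p₁₂^* π ∪ —) ∘ p₃^*`,
`m = (pr_B, 𝟙) : B × 𝒴 ⟶ B × (B × 𝒴)`, `B ◁ T` the external product of `T` with the identity of the passive first factor (stage 4's
`exists_isAlgebraicCorrespondence_whiskerLeft`, Fulton Ex. 16.1.1); every factor is induced by an algebraic cycle. For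
`π = Σᵢ p₁^* aᵢ ∪ p₂^* bᵢ` and `z = J_{t*} J_t^* y`: `p₁₂^* π ∪ p₃^* z = Σᵢ p₁^* aᵢ ∪ p₂^*(pr_B^* bᵢ ∪ pr_𝒴^* z)`,
`pr_𝒴^* J_{t*} = c₁ · j_{t*} q_t^*` (ONE scalar, §2) and the projection formula turn `pr_B^* bᵢ ∪ pr_𝒴^* z` into
`c₁ · j_{t*} j_t^*(pr_B^* bᵢ ∪ pr_𝒴^* y)`; `B ◁ T` acts on the second factor, `m^*` restricts to the diagonal, and (β′) at `(t, s)`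
gives `j_s^* m^* (B ◁ T)(…) = c₁ · j_s^*(pr_B^* (Δ^* π) ∪ pr_𝒴^* y)` (§4 `key`); `J_s^* pr_{𝒴*} = c₂ · q_{s*} j_s^*` (§3) and the projection
formula for `q_s` leave `c₁ ν · J_s^* y`, `ν · 1 = pr_{𝒴*} pr_B^* Δ^* π ≠ 0` (§1); `κ = (c₁ ν)⁻¹`. Only `Δ^* π ≠ 0` is used of `π`.

* §1 `complexGysin_snd_map_fst_ne_zero` — `pr_{Y*} pr_B^* ω ≠ 0` for `ω ≠ 0` in `H^{2g}(B(ℂ))` (slice, Künneth, vanishing).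
* §2 `exists_map_snd_complexGysin_fiberι_eq_smul` — `pr_𝒴^* J_{t*} = c₁ · j_{t*} q_t^*`, ONE `c₁ ≠ 0` for all `t`, all degrees.
* §3 `exists_map_fiberι_complexGysin_snd_eq_smul` — `J_s^* pr_{𝒴*} = c₂ · q_{s*} j_s^*` (clean base change, Fulton Thm. 6.2 (a)).
* §4 **`exists_fibreClassInverse_of_kunnethClass`** — THE ENGINE: from an algebraic `π ∈ Hᵉ(B) ⊗ H^{e'}(B)` with `Δ^* π ≠ 0`
  and the (β′)-inverse of `B × 𝒴` in degree `2q = e' + k`, an algebraic `T' : H^{k+2}(𝒴) → Hᵏ(𝒴)` with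
  `J_s^* T' J_{t*} J_t^* = J_s^*` for all `t, s`.
* The instantiations (odd degrees from the `H¹`-projector of the first gen-46 file; all degrees; the node-level statements
  `(β′)_{d+1} ⟹` all-degree inverses on every CM-pointed pencil of abelian `d`-folds) are in the sequel
  `Ring2HypothesesDescentFibreClassOddDegreesNodes`.

HONEST COLUMN. No definition, no named fact, no sorry; (β′)-type hypotheses are displayed, never asserted; nothing is
discharged; no node moves; the converse direction and the (θ)/(ρ) package are NOT claimed. Count once theirs:
`exists_isAlgebraicCorrespondence_whiskerLeft` (stage-4 seat), `complexGysin_cleanBaseChange`, `dominated_incidence`,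
`isCompactAbelianPencil_snd_comp` (ab-andre-2). References: Abdulali1994FamiliesAV (Conj. 5.3, Thm. 5.5 p. 1130); Andre1996Motifs
(§6.3 Remarque 2 p. 33); Tankeev2003 (Thm. 10.1); Fulton1998 (Thm. 6.2 (a), Prop. 1.7, §16.1 Ex. 16.1.1); FultonYoungTableaux1997
(App. B §B.1); Kleiman1968AlgebraicCycles (§1.3, §2); HatcherAT2002 (§3.2 Thm. 3.15, §3.3 Thm. 3.26).
-/

noncomputable section

set_option linter.dupNamespace false

open CategoryTheory CategoryTheory.Limits AlgebraicGeometry MonoidalCategory CartesianMonoidalCategory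
open Literature.AlgebraicGeometry Literature.AlgebraicGeometry.Motives Literature.AlgebraicGeometry.HodgeTheory
open Literature.AlgebraicTopology.SingularHomology
open Literature.AlgebraicGeometry.Milne1999 (IsOfCMType)
open Literature.AlgebraicGeometry.Deligne1982 (cmLocus)
open Summit.HodgeConjecture.HodgeConjecture.Ring2.AbelianAll
open Summit.HodgeConjecture.CorCM.Stage4 (exists_isAlgebraicCorrespondence_whiskerLeft)

namespace Summit.HodgeConjecture.HodgeConjecture.Theorems
/-! ## §1 The fibre integral of a non-zero top class over a constant factor does not vanish -/

/-- **`pr_{Y*} pr_B^* ω ≠ 0` for `0 ≠ ω ∈ H^{2g}(B(ℂ); ℂ)`** (`B`, `Y` smooth projective of dimensions `g`, `N`; any proof of the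
smooth projectivity of `B ⊗ Y` in dimension `m = g + N`). The slice `τ = (b₀, 𝟙) : Y ⟶ B ⊗ Y` has `pr_{Y*} τ_* 1 = 1 ≠ 0`; by
Künneth `τ_* 1` is a combination of cross products `pr_B^* a ∪ pr_Y^* w`, of which those with `deg a < 2g` die under `pr_{Y*}`
(vanishing below the fibre dimension) and those with `deg a = 2g` are multiples of `pr_B^* ω` (`H^{2g}(B(ℂ)) = ℂ · ω`,
`H⁰(Y(ℂ)) = ℂ · 1`); so `pr_{Y*}` maps `H^{2g}((B ⊗ Y)(ℂ))` onto the line through `pr_{Y*} pr_B^* ω`, which is therefore non-zero.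
[cite: HatcherAT2002, §3.2 Thm. 3.15 and §3.3 Thm. 3.26] [cite: FultonYoungTableaux1997, Appendix B §B.1 (5)–(6)] -/
theorem complexGysin_snd_map_fst_ne_zero {g N m : ℕ} {Bv Y : SchemeOver ℂ} (hB : IsSmoothProjective g Bv)
    (hY : IsSmoothProjective N Y) (hP : IsSmoothProjective m (Bv ⊗ Y)) (hm : m = g + N)
    {ω : complexBetti Bv (2 * g)} (hω : ω ≠ 0) :
    complexGysin complexOrientationFamily hP hY (snd Bv Y) (show 2 * g + 2 * N = 0 + 2 * m by omega)
      (complexBetti.map (fst Bv Y) (2 * g) ω) ≠ 0 := by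
  subst hm
  have hμ : complexOrientationFamily.HasPoincareDuality := OrientationFamily.hasPoincareDuality _
  haveI := connectedSpace_complexPoints hB
  obtain ⟨b₀⟩ : Nonempty (ComplexPoints Bv) := inferInstance
  -- `pr_{Y*}` in degree `2g`, and the slice
  set G : complexBetti (Bv ⊗ Y) (2 * g) →ₗ[ℂ] complexBetti Y 0 :=
    complexGysin complexOrientationFamily hP hY (snd Bv Y) (show 2 * g + 2 * N = 0 + 2 * (g + N) by omega) with hG
  have hslice : G (complexGysin complexOrientationFamily hY hP (lift (toSpecOver Y ≫ b₀) (𝟙 Y))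
      (show 0 + 2 * (g + N) = 2 * g + 2 * N by omega) (singularCohomology.one ℂ (ComplexPoints Y))) =
      singularCohomology.one ℂ (ComplexPoints Y) := by
    rw [hG, ← LinearMap.comp_apply, ← complexGysin_comp hμ hY hP hY (lift (toSpecOver Y ≫ b₀) (𝟙 Y)) (snd Bv Y)
      (show 0 + 2 * (g + N) = 2 * g + 2 * N by omega) (show 2 * g + 2 * N = 0 + 2 * (g + N) by omega)]
    simp only [lift_snd]
    rw [complexGysin_id hμ hY, LinearMap.id_apply]
  -- every class of `H^{2g}((B ⊗ Y)(ℂ))` is mapped into the line through `x₀ = pr_{Y*} pr_B^* ω`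
  set x₀ := G (complexBetti.map (fst Bv Y) (2 * g) ω) with hx₀
  have hline : ∀ u : complexBetti (Bv ⊗ Y) (2 * g), G u ∈ Submodule.span ℂ {x₀} := by
    intro u
    have hu := kunnethSpan_complexBetti hB hY (2 * g) u
    rw [← Submodule.mem_comap]
    refine (Submodule.span_le.mpr ?_) hu
    rintro _ ⟨i, j, hij, a, w, rfl⟩
    rw [SetLike.mem_coe, Submodule.mem_comap]
    rcases Nat.eq_zero_or_pos j with hj | hj
    · subst hj
      obtain rfl : i = 2 * g := by omega
      obtain ⟨t, rfl⟩ := exists_eq_smul_of_top complexOrientationFamily hB hω a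
      obtain ⟨r, hr⟩ := exists_eq_smul_one complexOrientationFamily hY w
      simp only [hr, map_smul, LinearMap.smul_apply, singularCohomology.map_one, cupProduct_one]
      exact Submodule.smul_mem _ _ (Submodule.smul_mem _ _ (Submodule.mem_span_singleton_self x₀))
    · rw [cupProduct_gradedComm_holds ℂ _ hij (show j + i = 2 * g by omega), map_smul, hG,
        complexGysin_cup_map_eq_zero_of_lt hP hY (snd Bv Y) (show j + i = 2 * g by omega) _ (by omega) w, smul_zero]
      exact Submodule.zero_mem _
  -- hence `x₀ ≠ 0`
  intro h0
  have h1 := hline (complexGysin complexOrientationFamily hY hP (lift (toSpecOver Y ≫ b₀) (𝟙 Y))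
      (show 0 + 2 * (g + N) = 2 * g + 2 * N by omega) (singularCohomology.one ℂ (ComplexPoints Y)))
  rw [hslice] at h1
  obtain ⟨a, ha⟩ := Submodule.mem_span_singleton.mp h1
  apply complexBetti_one_ne_zero hY
  rw [← ha]
  change a • x₀ = 0
  rw [h0, smul_zero]

/-! ## §2 `pr_𝒴^* J_{t*} = c₁ · j_{t*} q_t^*`: ONE non-zero scalar for all fibres and all degrees -/

variable {d : ℕ} {𝒴 S : SchemeOver ℂ} {f : 𝒴 ⟶ S}

/-- **Uniform base change for the product pencil `B × 𝒴 ⟶ S` along `pr_𝒴`.** For a compact pencil `f : 𝒴 ⟶ S` of abelian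
`d`-folds and the product pencil `pr_𝒴 ≫ f : B × 𝒴 ⟶ S` (relative dimension `d'`), there is ONE `c₁ ≠ 0` with
`pr_𝒴^*(J_{t*} x) = c₁ · j_{t*}(q_t^* x)` for every `t`, every degree and every `x ∈ Hᵃ(𝒴_t(ℂ); ℂ)` (`J_t`, `j_t` the fibre inclusions,
`q_t : (B × 𝒴)_t ⟶ 𝒴_t` the fibre map): gen 44's base change `exists_map_complexGysin_fiberι_eq_smul_of_over` (ONE scalar per fibre,
all degrees), compared across fibres in degree `0` by (φ) `fibreClassConstantOn_holds`; `c₁ ≠ 0` since `(0_B, 𝟙)^* pr_𝒴^* = 1` and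
`[𝒴_t] ≠ 0`. [cite: Fulton1998, Thm. 6.2 (a) and §19.1 proof of Prop. 19.1.1] [cite: FultonYoungTableaux1997, Appendix B §B.1 (5)] -/
theorem exists_map_snd_complexGysin_fiberι_eq_smul (hf : IsCompactAbelianPencil f d) (B : AbelianVariety ℂ) {d' : ℕ}
    (hF : IsCompactAbelianPencil (snd B.X 𝒴 ≫ f) d') :
    ∃ c : ℂ, c ≠ 0 ∧ ∀ (t : ComplexPoints S) ⦃a b : ℕ⦄ (hab : a + 2 * (d + 1) = b + 2 * d)
      (x : complexBetti (fiberOver f t) a),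
      complexBetti.map (snd B.X 𝒴) b
          (complexGysin complexOrientationFamily (hf.isSmoothProjective_fiberOver t) hf.isSmoothProjective_total
            (fiberι f t) hab x) =
        c • complexGysin complexOrientationFamily (hF.isSmoothProjective_fiberOver t) hF.isSmoothProjective_total
          (fiberι (snd B.X 𝒴 ≫ f) t) (show a + 2 * (d' + 1) = b + 2 * d' by omega)
          (complexBetti.map (fiberOverMap (snd B.X 𝒴) f t) a x) := by
  choose c hc using exists_map_complexGysin_fiberι_eq_smul_of_over hf hF
  haveI := connectedSpace_complexPoints hf.isSmoothProjective_base
  obtain ⟨t₀⟩ : Nonempty (ComplexPoints S) := inferInstance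
  -- degree `0`: `pr_𝒴^*[𝒴_t] = c_t · [(B × 𝒴)_t]`
  have h0 : ∀ t : ComplexPoints S,
      complexBetti.map (snd B.X 𝒴) 2 (fiberGysin hf t 0 (singularCohomology.one ℂ (ComplexPoints (fiberOver f t)))) =
        c t • fiberGysin hF t 0 (singularCohomology.one ℂ (ComplexPoints (fiberOver (snd B.X 𝒴 ≫ f) t))) := fun t ↦ by
    have h := hc t (show 0 + 2 * (d + 1) = 2 + 2 * d by omega) (singularCohomology.one ℂ _)
    rw [singularCohomology.map_one] at h
    exact h
  -- hence `c_t = c_{t₀}`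
  have hct : ∀ t, c t = c t₀ := fun t ↦ by
    have h := h0 t
    rw [fibreClassConstantOn_holds hf t t₀, fibreClassConstantOn_holds hF t t₀, h0 t₀] at h
    exact (smul_left_injective ℂ (fiberGysin_one_ne_zero hF t₀) h).symm
  refine ⟨c t₀, fun hc0 ↦ ?_, fun t a b hab x ↦ ?_⟩
  · apply fiberGysin_one_ne_zero hf t₀
    have h := h0 t₀
    rw [hc0, zero_smul] at h
    have hσ : ∀ (k : ℕ) (u : complexBetti 𝒴 k),
        complexBetti.map (lift (toSpecOver 𝒴 ≫ (1 : B.Points ℂ)) (𝟙 𝒴)) k (complexBetti.map (snd B.X 𝒴) k u) = u :=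
      fun k u ↦ by
        rw [← complexBetti.map_comp_apply', lift_snd, complexBetti.map_id]
        rfl
    rw [← hσ _ (fiberGysin hf t₀ 0 _), h, map_zero]
  · rw [← hct t]
    exact hc t hab x

/-! ## §3 `J_s^* pr_{𝒴*} = c₂ · q_{s*} j_s^*`: restricting a `pr_𝒴`-push-forward to a fibre -/

/-- **Base change for the push-forward along `pr_𝒴 : B × 𝒴 ⟶ 𝒴` restricted to the fibre at `s`**: the square
`(B × 𝒴)_s ⟶ B × 𝒴` over `𝒴_s ⟶ 𝒴` is cartesian of the expected dimensions `d' + (d+1) = (d'+1) + d`, so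
`J_s^*(pr_{𝒴*} u) = c₂ · q_{s*}(j_s^* u)` for all `u` and all degrees, ONE scalar `c₂` (the tree's PROVED `complexGysin_cleanBaseChange`,
incidence `dominated_incidence`). [cite: Fulton1998, Thm. 6.2 (a) and Prop. 1.7] -/
theorem exists_map_fiberι_complexGysin_snd_eq_smul (hf : IsCompactAbelianPencil f d) (B : AbelianVariety ℂ) {d' : ℕ}
    (hF : IsCompactAbelianPencil (snd B.X 𝒴 ≫ f) d') (s : ComplexPoints S) :
    ∃ K : ℂ, ∀ ⦃a b : ℕ⦄ (hab : a + 2 * (d + 1) = b + 2 * (d' + 1)) (u : complexBetti (B.X ⊗ 𝒴) a),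
      complexBetti.map (fiberι f s) b
          (complexGysin complexOrientationFamily hF.isSmoothProjective_total hf.isSmoothProjective_total (snd B.X 𝒴) hab u) =
        K • complexGysin complexOrientationFamily (hF.isSmoothProjective_fiberOver s) (hf.isSmoothProjective_fiberOver s)
          (fiberOverMap (snd B.X 𝒴) f s) (show a + 2 * d = b + 2 * d' by omega)
          (complexBetti.map (fiberι (snd B.X 𝒴 ≫ f) s) a u) := by
  haveI : IsProper S.hom := IsSmoothProjective.isProper_holds hf.isSmoothProjective_base
  haveI : IsClosedImmersion (fiberι (snd B.X 𝒴 ≫ f) s).left := Motives.isClosedImmersion_fiberι_left (snd B.X 𝒴 ≫ f) s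
  haveI := isClosedImmersion_lift_left_of_isSmoothProjective (hf.isSmoothProjective_fiberOver s)
    (fiberι (snd B.X 𝒴 ≫ f) s) (fiberOverMap (snd B.X 𝒴) f s)
  exact complexGysin_cleanBaseChange complexOrientationFamily hF.isSmoothProjective_total hf.isSmoothProjective_total
    (hf.isSmoothProjective_fiberOver s) (hF.isSmoothProjective_fiberOver s) (snd B.X 𝒴) (fiberι f s)
    (fiberι (snd B.X 𝒴 ≫ f) s) (fiberOverMap (snd B.X 𝒴) f s) (by omega) (dominated_incidence f (snd B.X 𝒴) s)

/-! ## §4 The engine: the partial trace of `(π ⊗ 1) ∘ (B ◁ T)` over `B` -/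

/-- **THE PARTIAL-TRACE ENGINE.** Let `f : 𝒴 ⟶ S` be a compact pencil of abelian `d`-folds, `B` a complex abelian variety of
dimension `g`, `pr_𝒴 ≫ f : B × 𝒴 ⟶ S` the product pencil (relative dimension `d' = g + d`). Let `π ∈ H^{2g}((B ⊗ B)(ℂ); ℂ)` be
ALGEBRAIC, in the Künneth piece `Hᵉ(B) ⊗ H^{e'}(B)` (`e + e' = 2g`), with `Δ^* π ≠ 0`; let `e' + k = 2q ≤ 2d'` and let
`T : H^{2q+2}((B ⊗ 𝒴)(ℂ)) → H^{2q}((B ⊗ 𝒴)(ℂ))` be induced by an algebraic cycle with `j_s^* T j_{t*} j_t^* = j_s^*` for all `t, s` (the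
degree-`q` clause of (β′) for the product pencil). THEN there is `T' : H^{k+2}(𝒴(ℂ)) → Hᵏ(𝒴(ℂ))` induced by an algebraic cycle on
`𝒴 × 𝒴` with `J_s^* T' (J_{t*} J_t^* y) = J_s^* y` for all `y ∈ Hᵏ(𝒴(ℂ); ℂ)` and all `t, s` — namely
`T' = (c₁ν)⁻¹ · pr_{𝒴*} ∘ m^* ∘ (B ◁ T) ∘ (p₁₂^* π ∪ —) ∘ p₃^*` (module docstring). [cite: Abdulali1994FamiliesAV, Conjecture 5.3 and Theorem 5.5 (p. 1130)]
[cite: Fulton1998, §16.1 Ex. 16.1.1, Prop. 16.1.1 and Thm. 6.2 (a)] [cite: Kleiman1968AlgebraicCycles, §1.3 and §2] -/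
theorem exists_fibreClassInverse_of_kunnethClass (hf : IsCompactAbelianPencil f d) (B : AbelianVariety ℂ) {d' : ℕ}
    (hF : IsCompactAbelianPencil (snd B.X 𝒴 ≫ f) d') (hd' : d' = B.dim + d)
    {e e' : ℕ} (hee' : e + e' = 2 * B.dim) {π : complexBetti (B.X ⊗ B.X) (2 * B.dim)}
    (hπK : π ∈ kunnethPiece B.X B.X hee') (hπalg : π ∈ algebraicClasses (B.X ⊗ B.X) B.dim)
    (hπΔ : complexBetti.map (lift (𝟙 B.X) (𝟙 B.X)) (2 * B.dim) π ≠ 0)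
    {k q : ℕ} (hkq : e' + k = 2 * q) (hq : q ≤ d') (hk₂ : k ≤ 2 * d + 2)
    {T : complexBetti (B.X ⊗ 𝒴) (2 * (q + 1)) →ₗ[ℂ] complexBetti (B.X ⊗ 𝒴) (2 * q)}
    (algT : IsAlgebraicCorrespondence (d' + 1) (d' + 1) (B.X ⊗ 𝒴) (B.X ⊗ 𝒴) T)
    (hT : ∀ (W : complexBetti (B.X ⊗ 𝒴) (2 * q)) (t s : ComplexPoints S),
      complexBetti.map (fiberι (snd B.X 𝒴 ≫ f) s) (2 * q)
          (T (fiberGysin hF t q (complexBetti.map (fiberι (snd B.X 𝒴 ≫ f) t) (2 * q) W))) =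
        complexBetti.map (fiberι (snd B.X 𝒴 ≫ f) s) (2 * q) W) :
    ∃ T' : complexBetti 𝒴 (k + 2) →ₗ[ℂ] complexBetti 𝒴 k,
      IsAlgebraicCorrespondence (d + 1) (d + 1) 𝒴 𝒴 T' ∧
      ∀ (y : complexBetti 𝒴 k) (t s : ComplexPoints S),
        complexBetti.map (fiberι f s) k
            (T' (complexGysin complexOrientationFamily (hf.isSmoothProjective_fiberOver t) hf.isSmoothProjective_total
              (fiberι f t) (show k + 2 * (d + 1) = k + 2 + 2 * d by omega) (complexBetti.map (fiberι f t) k y))) =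
          complexBetti.map (fiberι f s) k y := by
  have hμ : complexOrientationFamily.HasPoincareDuality := OrientationFamily.hasPoincareDuality _
  have hB : IsSmoothProjective B.dim B.X := AbelianVariety.isSmoothProjective_holds (A := B)
  have hY := hf.isSmoothProjective_total
  have hP := hF.isSmoothProjective_total
  have hBB := IsSmoothProjective.tensor_holds hB hB
  have hBP := IsSmoothProjective.tensor_holds hB hP
  haveI : IsProper S.hom := IsSmoothProjective.isProper_holds hf.isSmoothProjective_base
  -- §2: `pr_𝒴^* J_{t*} = c₁ · j_{t*} q_t^*`
  obtain ⟨c₁, hc₁, hBC1⟩ := exists_map_snd_complexGysin_fiberι_eq_smul hf B hF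
  -- the whisker `W = B ◁ T` (external product with the identity of the passive first factor)
  obtain ⟨W, hWalg, hW⟩ := exists_isAlgebraicCorrespondence_whiskerLeft hB hP hP algT
    (rfl : e + 2 * (q + 1) = e + 2 * (q + 1)) (rfl : e + 2 * q = e + 2 * q) (by omega)
  -- `ν · 1 = pr_{𝒴*} pr_B^* Δ^* π ≠ 0`
  obtain ⟨ν, hν⟩ := exists_eq_smul_one complexOrientationFamily hY
    (complexGysin complexOrientationFamily hP hY (snd B.X 𝒴) (show 2 * B.dim + 2 * (d + 1) = 0 + 2 * (d' + 1) by omega)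
      (complexBetti.map (fst B.X 𝒴) (2 * B.dim) (complexBetti.map (lift (𝟙 B.X) (𝟙 B.X)) (2 * B.dim) π)))
  have hν0 : ν ≠ 0 := by
    intro h0
    apply complexGysin_snd_map_fst_ne_zero hB hY hP (show d' + 1 = B.dim + (d + 1) by omega) hπΔ
    rw [hν, h0, zero_smul]
  -- pull-back identities
  have hid : ∀ (n : ℕ) (v : complexBetti (B.X ⊗ 𝒴) n), complexBetti.map (𝟙 (B.X ⊗ 𝒴)) n v = v := fun n v ↦ by
    rw [complexBetti.map_id]
    rfl
  have hp12 : ∀ (a : complexBetti B.X e) (b : complexBetti B.X e'),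
      complexBetti.map (B.X ◁ fst B.X 𝒴) (2 * B.dim)
          (cupProduct hee' (complexBetti.map (fst B.X B.X) e a) (complexBetti.map (snd B.X B.X) e' b)) =
        cupProduct hee' (complexBetti.map (fst B.X (B.X ⊗ 𝒴)) e a)
          (complexBetti.map (snd B.X (B.X ⊗ 𝒴)) e' (complexBetti.map (fst B.X 𝒴) e' b)) := fun a b ↦ by
    rw [complexBetti.map_cupProduct, ← complexBetti.map_comp_apply', ← complexBetti.map_comp_apply', whiskerLeft_fst,
      whiskerLeft_snd, complexBetti.map_comp_apply']
  have hm : ∀ (a : complexBetti B.X e) (v : complexBetti (B.X ⊗ 𝒴) (2 * q)),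
      complexBetti.map (lift (fst B.X 𝒴) (𝟙 (B.X ⊗ 𝒴))) (e + 2 * q)
          (cupProduct (rfl : e + 2 * q = e + 2 * q) (complexBetti.map (fst B.X (B.X ⊗ 𝒴)) e a)
            (complexBetti.map (snd B.X (B.X ⊗ 𝒴)) (2 * q) v)) =
        cupProduct (rfl : e + 2 * q = e + 2 * q) (complexBetti.map (fst B.X 𝒴) e a) v := fun a v ↦ by
    rw [complexBetti.map_cupProduct, ← complexBetti.map_comp_apply', ← complexBetti.map_comp_apply', lift_fst, lift_snd,
      hid]
  have hq_ : ∀ (t : ComplexPoints S) (n : ℕ) (w : complexBetti 𝒴 n),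
      complexBetti.map (fiberOverMap (snd B.X 𝒴) f t) n (complexBetti.map (fiberι f t) n w) =
        complexBetti.map (fiberι (snd B.X 𝒴 ≫ f) t) n (complexBetti.map (snd B.X 𝒴) n w) := fun t n w ↦ by
    rw [← complexBetti.map_comp_apply', fiberOverMap_comp_fiberι, complexBetti.map_comp_apply']
  -- the operator
  let T₀ : complexBetti 𝒴 (k + 2) →ₗ[ℂ] complexBetti 𝒴 k :=
    complexGysin complexOrientationFamily hP hY (snd B.X 𝒴) (show e + 2 * q + 2 * (d + 1) = k + 2 * (d' + 1) by omega) ∘ₗ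
      (complexBetti.map (lift (fst B.X 𝒴) (𝟙 (B.X ⊗ 𝒴))) (e + 2 * q)).hom ∘ₗ W ∘ₗ
      cupProduct (show 2 * B.dim + (k + 2) = e + 2 * (q + 1) by omega)
        (complexBetti.map (B.X ◁ fst B.X 𝒴) (2 * B.dim) π) ∘ₗ
      (complexBetti.map (snd B.X (B.X ⊗ 𝒴) ≫ snd B.X 𝒴) (k + 2)).hom
  refine ⟨(c₁ * ν)⁻¹ • T₀, ?_, fun y t s ↦ ?_⟩
  · -- algebraicity: every factor is induced by an algebraic cycle
    refine IsAlgebraicCorrespondence.smul hY hY ?_ _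
    have hγP : complexBetti.map (B.X ◁ fst B.X 𝒴) (2 * B.dim) π ∈ algebraicClasses (B.X ⊗ (B.X ⊗ 𝒴)) B.dim :=
      fulton1998_map_mem_algebraicClasses_holds (B.X ◁ fst B.X 𝒴) hBB hBP B.dim π hπalg
    have hCu : cupProduct (show 2 * B.dim + (k + 2) = e + 2 * (q + 1) by omega)
          (complexBetti.map (B.X ◁ fst B.X 𝒴) (2 * B.dim) π) =
        (cupProduct (show k + 2 + 2 * B.dim = e + 2 * (q + 1) by omega)).flip
          (complexBetti.map (B.X ◁ fst B.X 𝒴) (2 * B.dim) π) := by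
      refine LinearMap.ext fun x ↦ ?_
      rw [LinearMap.flip_apply, cupProduct_gradedComm_holds ℂ _ (show 2 * B.dim + (k + 2) = e + 2 * (q + 1) by omega)
        (show k + 2 + 2 * B.dim = e + 2 * (q + 1) by omega), (Nat.even_mul.mpr (Or.inl (even_two_mul _))).neg_one_pow,
        one_smul]
    have algCu : IsAlgebraicCorrespondence (B.dim + (d' + 1)) (B.dim + (d' + 1)) (B.X ⊗ (B.X ⊗ 𝒴)) (B.X ⊗ (B.X ⊗ 𝒴))
        (cupProduct (show 2 * B.dim + (k + 2) = e + 2 * (q + 1) by omega)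
          (complexBetti.map (B.X ◁ fst B.X 𝒴) (2 * B.dim) π)) := by
      rw [hCu]
      exact isAlgebraicCorrespondence_flip_cupProduct_of_mem_algebraicClasses hBP
        (show k + 2 + 2 * B.dim = e + 2 * (q + 1) by omega) (by omega) hγP
    have algp₃ : IsAlgebraicCorrespondence (B.dim + (d' + 1)) (d + 1) (B.X ⊗ (B.X ⊗ 𝒴)) 𝒴
        (complexBetti.map (snd B.X (B.X ⊗ 𝒴) ≫ snd B.X 𝒴) (k + 2)).hom :=
      isAlgebraicCorrespondence_map hBP hY _ (by omega)
    have algm : IsAlgebraicCorrespondence (d' + 1) (B.dim + (d' + 1)) (B.X ⊗ 𝒴) (B.X ⊗ (B.X ⊗ 𝒴))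
        (complexBetti.map (lift (fst B.X 𝒴) (𝟙 (B.X ⊗ 𝒴))) (e + 2 * q)).hom :=
      isAlgebraicCorrespondence_map hP hBP _ (by omega)
    have algG : IsAlgebraicCorrespondence (d + 1) (d' + 1) 𝒴 (B.X ⊗ 𝒴)
        (complexGysin complexOrientationFamily hP hY (snd B.X 𝒴)
          (show e + 2 * q + 2 * (d + 1) = k + 2 * (d' + 1) by omega)) :=
      isAlgebraicCorrespondence_complexGysin complexOrientationFamily hμ hP hY (snd B.X 𝒴) _
        (show k + (2 * (d + 1) - k) = 2 * (d + 1) by omega)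
    have h1 := IsAlgebraicCorrespondence.comp hBP hBP hY algp₃ algCu (by omega)
    have h2 := IsAlgebraicCorrespondence.comp hBP hBP hY h1 hWalg (by omega)
    have h3 := IsAlgebraicCorrespondence.comp hP hBP hY h2 algm (by omega)
    exact IsAlgebraicCorrespondence.comp hY hP hY h3 algG (by omega)
  · -- the identity `J_s^* T' (J_{t*} J_t^* y) = J_s^* y`
    obtain ⟨c₂, hBC2⟩ := exists_map_fiberι_complexGysin_snd_eq_smul hf B hF s
    set z : complexBetti 𝒴 (k + 2) := complexGysin complexOrientationFamily (hf.isSmoothProjective_fiberOver t) hY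
      (fiberι f t) (show k + 2 * (d + 1) = k + 2 + 2 * d by omega) (complexBetti.map (fiberι f t) k y) with hz
    -- (K) the key identity, linear in `π`: proved on cross products
    let L : complexBetti (B.X ⊗ B.X) (2 * B.dim) →ₗ[ℂ] complexBetti (fiberOver (snd B.X 𝒴 ≫ f) s) (e + 2 * q) :=
      (complexBetti.map (fiberι (snd B.X 𝒴 ≫ f) s) (e + 2 * q)).hom ∘ₗ
        (complexBetti.map (lift (fst B.X 𝒴) (𝟙 (B.X ⊗ 𝒴))) (e + 2 * q)).hom ∘ₗ W ∘ₗ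
        (cupProduct (show 2 * B.dim + (k + 2) = e + 2 * (q + 1) by omega)).flip
          (complexBetti.map (snd B.X (B.X ⊗ 𝒴) ≫ snd B.X 𝒴) (k + 2) z) ∘ₗ
        (complexBetti.map (B.X ◁ fst B.X 𝒴) (2 * B.dim)).hom
    let R : complexBetti (B.X ⊗ B.X) (2 * B.dim) →ₗ[ℂ] complexBetti (fiberOver (snd B.X 𝒴 ≫ f) s) (e + 2 * q) :=
      c₁ • ((complexBetti.map (fiberι (snd B.X 𝒴 ≫ f) s) (e + 2 * q)).hom ∘ₗ
        (cupProduct (show 2 * B.dim + k = e + 2 * q by omega)).flip (complexBetti.map (snd B.X 𝒴) k y) ∘ₗ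
        (complexBetti.map (fst B.X 𝒴) (2 * B.dim)).hom ∘ₗ
        (complexBetti.map (lift (𝟙 B.X) (𝟙 B.X)) (2 * B.dim)).hom)
    have key : L π = R π := by
      refine LinearMap.eqOn_span (f := L) (g := R) ?_ hπK
      rintro _ ⟨a, b, rfl⟩
      -- unfold both sides
      change complexBetti.map (fiberι (snd B.X 𝒴 ≫ f) s) (e + 2 * q)
          (complexBetti.map (lift (fst B.X 𝒴) (𝟙 (B.X ⊗ 𝒴))) (e + 2 * q)
            (W (cupProduct _ (complexBetti.map (B.X ◁ fst B.X 𝒴) (2 * B.dim)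
              (cupProduct hee' (complexBetti.map (fst B.X B.X) e a) (complexBetti.map (snd B.X B.X) e' b)))
              (complexBetti.map (snd B.X (B.X ⊗ 𝒴) ≫ snd B.X 𝒴) (k + 2) z)))) =
        c₁ • complexBetti.map (fiberι (snd B.X 𝒴 ≫ f) s) (e + 2 * q)
          (cupProduct _ (complexBetti.map (fst B.X 𝒴) (2 * B.dim)
            (complexBetti.map (lift (𝟙 B.X) (𝟙 B.X)) (2 * B.dim)
              (cupProduct hee' (complexBetti.map (fst B.X B.X) e a) (complexBetti.map (snd B.X B.X) e' b))))
            (complexBetti.map (snd B.X 𝒴) k y))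
      -- the test class `x = pr_B^* b ∪ pr_𝒴^* z = c₁ · j_{t*} j_t^* W₀`, `W₀ = pr_B^* b ∪ pr_𝒴^* y`
      set W₀ : complexBetti (B.X ⊗ 𝒴) (2 * q) :=
        cupProduct hkq (complexBetti.map (fst B.X 𝒴) e' b) (complexBetti.map (snd B.X 𝒴) k y) with hW₀
      have hx : cupProduct (show e' + (k + 2) = 2 * (q + 1) by omega) (complexBetti.map (fst B.X 𝒴) e' b)
            (complexBetti.map (snd B.X 𝒴) (k + 2) z) =
          c₁ • fiberGysin hF t q (complexBetti.map (fiberι (snd B.X 𝒴 ≫ f) t) (2 * q) W₀) := by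
        rw [hz, hBC1 t (show k + 2 * (d + 1) = k + 2 + 2 * d by omega), map_smul,
          ← complexGysin_cup hμ (hF.isSmoothProjective_fiberOver t) hP (fiberι (snd B.X 𝒴 ≫ f) t) hkq
            (show 2 * q + 2 * (d' + 1) = 2 * (q + 1) + 2 * d' by omega) (show k + 2 * (d' + 1) = k + 2 + 2 * d' by omega)
            (show e' + (k + 2) = 2 * (q + 1) by omega),
          hq_ t, ← complexBetti.map_cupProduct]
        rfl
      rw [hp12, cupProduct_assoc hee' (show e' + (k + 2) = 2 * (q + 1) by omega)
          (show 2 * B.dim + (k + 2) = e + 2 * (q + 1) by omega) (rfl : e + 2 * (q + 1) = e + 2 * (q + 1)),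
        complexBetti.map_comp_apply' (snd B.X (B.X ⊗ 𝒴)) (snd B.X 𝒴), ← complexBetti.map_cupProduct, hx, map_smul,
        map_smul, map_smul, map_smul, map_smul, hW a, hm, complexBetti.map_cupProduct, hT W₀ t s, hW₀,
        map_lift_cross hee' a b]
      simp only [complexBetti.map_cupProduct]
      rw [cupProduct_assoc hee' hkq (show 2 * B.dim + k = e + 2 * q by omega) (rfl : e + 2 * q = e + 2 * q)]
    -- unfold `key`
    have key' : complexBetti.map (fiberι (snd B.X 𝒴 ≫ f) s) (e + 2 * q)
        (complexBetti.map (lift (fst B.X 𝒴) (𝟙 (B.X ⊗ 𝒴))) (e + 2 * q)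
          (W (cupProduct (show 2 * B.dim + (k + 2) = e + 2 * (q + 1) by omega)
            (complexBetti.map (B.X ◁ fst B.X 𝒴) (2 * B.dim) π)
            (complexBetti.map (snd B.X (B.X ⊗ 𝒴) ≫ snd B.X 𝒴) (k + 2) z)))) =
        c₁ • complexBetti.map (fiberι (snd B.X 𝒴 ≫ f) s) (e + 2 * q)
          (cupProduct (show 2 * B.dim + k = e + 2 * q by omega)
            (complexBetti.map (fst B.X 𝒴) (2 * B.dim) (complexBetti.map (lift (𝟙 B.X) (𝟙 B.X)) (2 * B.dim) π))
            (complexBetti.map (snd B.X 𝒴) k y)) := key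
    -- `c₂ · q_{s*}((j_s ≫ pr_B)^* Δ^*π) = ν · 1`
    have hνs : c₂ • complexGysin complexOrientationFamily (hF.isSmoothProjective_fiberOver s)
          (hf.isSmoothProjective_fiberOver s) (fiberOverMap (snd B.X 𝒴) f s)
          (show 2 * B.dim + 2 * d = 0 + 2 * d' by omega)
          (complexBetti.map (fiberι (snd B.X 𝒴 ≫ f) s) (2 * B.dim)
            (complexBetti.map (fst B.X 𝒴) (2 * B.dim) (complexBetti.map (lift (𝟙 B.X) (𝟙 B.X)) (2 * B.dim) π))) =
        ν • singularCohomology.one ℂ (ComplexPoints (fiberOver f s)) := by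
      rw [← hBC2 (show 2 * B.dim + 2 * (d + 1) = 0 + 2 * (d' + 1) by omega), hν, map_smul, singularCohomology.map_one]
    have hνs' : ∀ v : complexBetti (fiberOver f s) k,
        c₂ • cupProduct (show k + 0 = k by omega) v
          (complexGysin complexOrientationFamily (hF.isSmoothProjective_fiberOver s)
            (hf.isSmoothProjective_fiberOver s) (fiberOverMap (snd B.X 𝒴) f s)
            (show 2 * B.dim + 2 * d = 0 + 2 * d' by omega)
            (complexBetti.map (fiberι (snd B.X 𝒴 ≫ f) s) (2 * B.dim)
              (complexBetti.map (fst B.X 𝒴) (2 * B.dim) (complexBetti.map (lift (𝟙 B.X) (𝟙 B.X)) (2 * B.dim) π)))) =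
        ν • v := fun v ↦ by
      rw [← map_smul (cupProduct (show k + 0 = k by omega) v) c₂, hνs, map_smul, cupProduct_one]
    -- assemble
    rw [LinearMap.smul_apply, map_smul]
    change (c₁ * ν)⁻¹ • complexBetti.map (fiberι f s) k
        (complexGysin complexOrientationFamily hP hY (snd B.X 𝒴) _
          (complexBetti.map (lift (fst B.X 𝒴) (𝟙 (B.X ⊗ 𝒴))) (e + 2 * q)
            (W (cupProduct _ (complexBetti.map (B.X ◁ fst B.X 𝒴) (2 * B.dim) π)
              (complexBetti.map (snd B.X (B.X ⊗ 𝒴) ≫ snd B.X 𝒴) (k + 2) z))))) = _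
    rw [hBC2 (show e + 2 * q + 2 * (d + 1) = k + 2 * (d' + 1) by omega), key', map_smul, complexBetti.map_cupProduct,
      ← hq_ s, cupProduct_gradedComm_holds ℂ _ (show 2 * B.dim + k = e + 2 * q by omega)
        (show k + 2 * B.dim = e + 2 * q by omega), (Nat.even_mul.mpr (Or.inl (even_two_mul _))).neg_one_pow, one_smul,
      complexGysin_cup hμ (hF.isSmoothProjective_fiberOver s) (hf.isSmoothProjective_fiberOver s)
        (fiberOverMap (snd B.X 𝒴) f s) (show k + 2 * B.dim = e + 2 * q by omega) _
        (show 2 * B.dim + 2 * d = 0 + 2 * d' by omega) (show k + 0 = k by omega),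
      smul_comm c₂ c₁, hνs', smul_smul, smul_smul, mul_assoc, inv_mul_cancel₀ (mul_ne_zero hc₁ hν0), one_smul]

end Summit.HodgeConjecture.HodgeConjecture.Theorems

end
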